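/-
Copyright (c) 2026 the pub-hodgecm-mathlib formalisation cell (harness21).  Prover seat hodgecm-mathlib-K2E1-p16 (g2), Track B ∕ K2-LIT, h413 = `stmt-HodgeConjecture-24833`,
route of record `HCCMUnconditional`; R90-TF section S8 «ContSpec-n½» (dealer R90-CS-plan (g0), LEAD K2E1-plan (g7)), «U(Φ₃) χ-TWIN row 7a part 1» (TWIN-DAG v1 §A row 7a): the N = 3 heads
of ★ `K2E1ChiConvDataLettersMaximalLevelU2` (K2-defs1 (g6)) — its §1–§4 are RANK-GENERIC ★ and reused by import.
-/
import Summits.HodgeConjecture.HodgeConjecture.Theorems.K2E1ChiConvDataLettersMaximalLevelU2   -- ★ p860121 (K2-defs1 g6): RANK-GENERIC §1–§4 (`exists_symm_sphericalWeight_supported_re_integral_pos`, `sndHom_mem_of_selfConv_ne_zero`, `apply_eq_apply_one_of_sndHom_mem`, `integral_selfConv_mul_flatSectionU_eq_sphericalTransform_mul`) over `(quasiSplit F E c N)`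
import Summits.HodgeConjecture.HodgeConjecture.Theorems.K2E1BLUniquenessU3                      -- ★ p859028 (K2E1-p02): `one_mem_closure_setOf_one_lt_borelHeight_three` (arch ray at rank 3, NO `c² = 1`)
import HarnessLib

/-!
# S8 «U(Φ₃) χ-TWIN» row 7a part 1 — `K2E1ChiConvDataLettersMaximalLevelU3`: convData_χ₃'s LETTERS `hfam`∕`hnc` AT MAXIMAL LEVEL `K = U(Φ₃)(𝔸) ∩ GL₃(𝒪̂)·K_∞` for `χ_∞ = 1`
# (bi-`K`-invariant spherical test functions; the N = 3 twin of the §5 heads of ★ `K2E1ChiConvDataLettersMaximalLevelU2`)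

Cell `pub/hodgecm-mathlib`, crux H413 = `stmt-HodgeConjecture-24833`; R90-TF section S8.  THEOREMS ONLY (no `def`, no `instance`, no notation, no named-fact hypothesis, no `sorry`); lane
`--supports stmt-HodgeConjecture-24833 --as helper` (count-neutral).  Closes no socket.  WHY MECHANICAL: §1–§4 of the N = 2 original are typed over `(quasiSplit F E c N)` (★, imported);
its §5 pins `N = 2` only through ★ `one_mem_closure_setOf_one_lt_borelHeight_two (c² = 1)` (the non-constancy ray), replaced at rank 3 by ★
`K2E1BLUniquenessU3.one_mem_closure_setOf_one_lt_borelHeight_three` (no `c² = 1`); ★ CM Iwasawa `exists_mem_borelAdelic_mul_mem_standardMaximalCompactGL_cm` and ★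
`integral_selfConv_mul_borelHeight_cpow_cm` are rank-generic.  Heads at `V := chiSectionSpace χ K (fun _ => 1)` (★ rank-generic def; the χ₂ = 1 sub-family at N = 3 — RULING S8-R10:
the pair edition re-reads `hVinf`∕the right law on `chiSectionSpacePair`, D-S8-3 ED.2), bytes = ★ TWIN #1 `exists_chi_convData_cm_three`'s `hfam`∕`hnc`.
* §5 **`exists_testFunction_sphericalTransform_maximalLevel_cm_three`**, HEADS **`hfam_maximalLevel_cm_three`**, **`hnc_maximalLevel_cm_three`**.
HONEST LABEL: HC_CM is proved only modulo the 7 printed citations (2 remaining named inputs: hLiu418 = `stmt-HodgeConjecture-24832`, h413 = `stmt-HodgeConjecture-24833`) until rung 0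
closes; count-neutral helper, closes no socket.

## References
* [BernsteinLapid2019] J. Bernstein, E. Lapid, *On the meromorphic continuation of Eisenstein series*, J. AMS 37 (2024), §4 Claims 1, 4–5 (p. 10).
* [Bump1997] D. Bump, *Automorphic Forms and Representations* (1997), proof of Lemma 2.3.2.
-/

set_option autoImplicit false
set_option linter.dupNamespace false  -- the mandated namespace repeats the summit's segment (`HodgeConjecture.HodgeConjecture`)

noncomputable section

open MeasureTheory Measure NumberField NumberField.mixedEmbedding IsDedekindDomain Set Filter Complex Topology
open scoped ENNReal NNReal MatrixGroups Matrix Classical Pointwise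
open Literature.NumberTheory Literature.NumberTheory.Automorphic Literature.NumberTheory.Automorphic.UnitaryGroup
open AdelicGroupData
open Literature.NumberTheory.GaloisRepresentations (HeckeCharacter)
open Summit.HodgeConjecture.HodgeConjecture.Cruxes.H413.K2E1SphericalHeckeEigenSectionU2
open Summit.HodgeConjecture.HodgeConjecture.Cruxes.H413.K2E1SphericalHeckeGoodTestFunctionU2
open Summit.HodgeConjecture.HodgeConjecture.Cruxes.H413.K2E1HeightFunctionU3 (borelHeight_one)
open Summit.HodgeConjecture.HodgeConjecture.Cruxes.H413.K2E1SphericalTestFunctionGL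
open Summit.HodgeConjecture.HodgeConjecture.Cruxes.H413.K2E1BLSelfConvolutionU2
open Summit.HodgeConjecture.HodgeConjecture.Cruxes.H413.K2E1BorelEisensteinU
open Summit.HodgeConjecture.HodgeConjecture.Cruxes.H413.K2E1CharacterEisensteinU2Defs
open Summit.HodgeConjecture.HodgeConjecture.Cruxes.H413.K2E1ChiSectionSpaceU2Defs
open Summit.HodgeConjecture.HodgeConjecture.Cruxes.H413.K2E1BLUniquenessU2 (exists_ne_zero_one_lt_borelHeight)
open Summit.HodgeConjecture.HodgeConjecture.Cruxes.H413.K2E1BLUniquenessU3 (one_mem_closure_setOf_one_lt_borelHeight_three)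
open Summit.HodgeConjecture.HodgeConjecture.Cruxes.H413.K2E1SphericalTransformLevelSetsCountableU (exists_sphericalTransform_ne)
open Summit.HodgeConjecture.HodgeConjecture.Cruxes.H413.K2E1ChiConvDataLettersMaximalLevelU2

namespace Summit.HodgeConjecture.HodgeConjecture.Cruxes.H413.K2E1ChiConvDataLettersMaximalLevelU3

/-! ## §4 HEADS (CM, `N = 2`): convData_χ's letters `hfam`∕`hnc` at `V := chiSectionSpace χ K 1`, `χ_∞ = 1` -/

section Heads

variable (L : Type) [Field L] [NumberField L] [IsCMField L]
variable [MeasurableSpace (quasiSplit (↥(maximalRealSubfield L)) L (IsCMField.complexConj L) 3).Adelic] [BorelSpace (quasiSplit (↥(maximalRealSubfield L)) L (IsCMField.complexConj L) 3).Adelic]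
variable (νG : Measure (quasiSplit (↥(maximalRealSubfield L)) L (IsCMField.complexConj L) 3).Adelic) [νG.IsHaarMeasure] [SFinite νG]
variable {χ : HeckeCharacter L}

/-- The common core of both heads: for every `z₀` a symmetric smooth `η ≥ 0` (★ P5c) whose self-convolution `h = η ∗ η` acts on all `f_z^φ`, `φ ∈ V(χ, K, 1)` (with `φ ∘ ι = φ(1)`), by the ENTIRE
spherical transform `ĥ`, with `ĥ(z₀) ≠ 0` (`= η̂(z₀)²`, ★ `integral_selfConv_mul_borelHeight_cpow_cm`) and `ĥ` NON-CONSTANT (★ T7 `exists_sphericalTransform_ne`: `h ≥ 0` real, `h(1) ≠ 0`,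
`1 ∈ closure{H > 1}`). [cite: Langlands1976, §6 (p. 167)] [cite: BernsteinLapid2019, §4 Claim 1] [cite: MoeglinWaldspurger1995, II.1.2] -/
theorem exists_testFunction_sphericalTransform_maximalLevel_cm_three
    (hVinf : ∀ φ ∈ chiSectionSpace χ (((standardMaximalCompactGL 3 L).comap (adelicVal (↥(maximalRealSubfield L)) L (IsCMField.complexConj L) 3 ((StdForm.antidiagonal 3).over L)) :
      Subgroup (quasiSplit (↥(maximalRealSubfield L)) L (IsCMField.complexConj L) 3).Adelic)) (fun _ => 1),
      ∀ a : arch (↥(maximalRealSubfield L)) L (IsCMField.complexConj L) 3 ((StdForm.antidiagonal 3).over L), φ (archToAdelic (↥(maximalRealSubfield L)) L (IsCMField.complexConj L) 3 _ a) = φ 1)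
    (z₀ : ℂ) :
    ∃ η : GL (Fin 3) (AdeleRing (𝓞 L) L) → ℝ, IsTestFunctionGL 3 L η ∧ (∀ g, 0 ≤ η g) ∧ (∀ g, η g⁻¹ = η g) ∧
      ∃ s : ℂ → ℂ, Differentiable ℂ s ∧ s z₀ ≠ 0 ∧ (∃ z₁ z₂ : ℂ, s z₁ ≠ s z₂) ∧
        ∀ z : ℂ, ∀ φ ∈ chiSectionSpace χ (((standardMaximalCompactGL 3 L).comap (adelicVal (↥(maximalRealSubfield L)) L (IsCMField.complexConj L) 3 ((StdForm.antidiagonal 3).over L)) :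
            Subgroup (quasiSplit (↥(maximalRealSubfield L)) L (IsCMField.complexConj L) 3).Adelic)) (fun _ => 1),
          ∀ x : (quasiSplit (↥(maximalRealSubfield L)) L (IsCMField.complexConj L) 3).Adelic,
            (∫ y, (fun y : (quasiSplit (↥(maximalRealSubfield L)) L (IsCMField.complexConj L) 3).Adelic =>
                orbitalSmoothing νG (fun x : (quasiSplit (↥(maximalRealSubfield L)) L (IsCMField.complexConj L) 3).Adelic => ((η (adelicVal (↥(maximalRealSubfield L)) L (IsCMField.complexConj L) 3 ((StdForm.antidiagonal 3).over L) x) : ℝ) : ℂ))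
                  (fun x : (quasiSplit (↥(maximalRealSubfield L)) L (IsCMField.complexConj L) 3).Adelic => ((η (adelicVal (↥(maximalRealSubfield L)) L (IsCMField.complexConj L) 3 ((StdForm.antidiagonal 3).over L) x) : ℝ) : ℂ)) y) y *
              flatSectionU φ z (x * y) ∂νG) = s z * flatSectionU φ z x := by
  haveI := t2Space_quasiSplitAdelic (F := ↥(maximalRealSubfield L)) (E := L) (c := IsCMField.complexConj L) (N := 3)
  have hemb : IsClosedEmbedding (adelicVal (↥(maximalRealSubfield L)) L (IsCMField.complexConj L) 3 ((StdForm.antidiagonal 3).over L)) :=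
    (isClosed_adelic (↥(maximalRealSubfield L)) L (IsCMField.complexConj L) 3 ((StdForm.antidiagonal 3).over L)).isClosedEmbedding_subtypeVal
  obtain ⟨η, hηt, hη0, hη1, hηinv, -, hηKU, hsuppη, hre⟩ := exists_symm_sphericalWeight_supported_re_integral_pos (F := ↥(maximalRealSubfield L)) (E := L) (c := IsCMField.complexConj L) (N := 3) νG z₀
  set ηt : (quasiSplit (↥(maximalRealSubfield L)) L (IsCMField.complexConj L) 3).Adelic → ℂ :=
    fun x => ((η (adelicVal (↥(maximalRealSubfield L)) L (IsCMField.complexConj L) 3 ((StdForm.antidiagonal 3).over L) x) : ℝ) : ℂ) with hηt_def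
  have hηr_c : Continuous fun x : (quasiSplit (↥(maximalRealSubfield L)) L (IsCMField.complexConj L) 3).Adelic => η (adelicVal (↥(maximalRealSubfield L)) L (IsCMField.complexConj L) 3 ((StdForm.antidiagonal 3).over L) x) :=
    hηt.continuous.comp hemb.continuous
  have hηr_s : HasCompactSupport fun x : (quasiSplit (↥(maximalRealSubfield L)) L (IsCMField.complexConj L) 3).Adelic => η (adelicVal (↥(maximalRealSubfield L)) L (IsCMField.complexConj L) 3 ((StdForm.antidiagonal 3).over L) x) :=
    hηt.hasCompactSupport.comp_isClosedEmbedding hemb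
  have hηc : Continuous ηt := Complex.continuous_ofReal.comp hηr_c
  have hηs : HasCompactSupport ηt := hηr_s.comp_left Complex.ofReal_zero
  have hηK : ∀ k : (quasiSplit (↥(maximalRealSubfield L)) L (IsCMField.complexConj L) 3).Adelic,
      adelicVal (↥(maximalRealSubfield L)) L (IsCMField.complexConj L) 3 ((StdForm.antidiagonal 3).over L) k ∈ standardMaximalCompactGL 3 L → ∀ x, ηt (k * x) = ηt x := by
    intro k hk x
    have e := hηKU k 1 hk (by rw [map_one]; exact (standardMaximalCompactGL 3 L).one_mem) x
    rw [mul_one] at e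
    simp only [hηt_def, e]
  set h : (quasiSplit (↥(maximalRealSubfield L)) L (IsCMField.complexConj L) 3).Adelic → ℂ := fun y => orbitalSmoothing νG ηt ηt y with hh_def
  have hhc : Continuous h := continuous_selfConv νG hηc hηs
  have hhs : HasCompactSupport h := hasCompactSupport_selfConv νG hηs
  have hhK : ∀ k : (quasiSplit (↥(maximalRealSubfield L)) L (IsCMField.complexConj L) 3).Adelic,
      adelicVal (↥(maximalRealSubfield L)) L (IsCMField.complexConj L) 3 ((StdForm.antidiagonal 3).over L) k ∈ standardMaximalCompactGL 3 L → ∀ y, h (k * y) = h y :=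
    fun k hk y => selfConv_mul_left νG (K := {k | adelicVal (↥(maximalRealSubfield L)) L (IsCMField.complexConj L) 3 ((StdForm.antidiagonal 3).over L) k ∈ standardMaximalCompactGL 3 L})
      (fun k hk x => hηK k hk x) hk y
  have hhsupp : ∀ y, h y ≠ 0 → GLn.sndHom 3 L (adelicVal (↥(maximalRealSubfield L)) L (IsCMField.complexConj L) 3 ((StdForm.antidiagonal 3).over L) y) ∈ glFiniteIntegralLevel 3 L :=
    fun y hy => sndHom_mem_of_selfConv_ne_zero νG hηt hsuppη hy
  set s : ℂ → ℂ := fun z => ∫ y, h y * (((borelHeight y : ℝ≥0) : ℝ) : ℂ) ^ z ∂νG with hs_def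
  have hsd : Differentiable ℂ s := differentiable_integral_mul_borelHeight_cpow νG hhc hhs
  have hs0 : s z₀ ≠ 0 := by
    have e : s z₀ = (∫ x, ηt x * (((borelHeight x : ℝ≥0) : ℝ) : ℂ) ^ z₀ ∂νG) * (∫ x, ηt x * (((borelHeight x : ℝ≥0) : ℝ) : ℂ) ^ z₀ ∂νG) :=
      integral_selfConv_mul_borelHeight_cpow_cm L νG hηK hηc hηs z₀
    have hne : (∫ x, ηt x * (((borelHeight x : ℝ≥0) : ℝ) : ℂ) ^ z₀ ∂νG) ≠ 0 := fun h0 => hre.ne' (by simp only [hηt_def] at h0; rw [h0, Complex.zero_re])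
    rw [e]; exact mul_ne_zero hne hne
  have hreal : ∀ y, ((((h y).re : ℝ)) : ℂ) = h y := fun y =>
    (Complex.conj_eq_iff_re.1 (conj_selfConv νG (fun g => by simp only [hηt_def, Complex.conj_ofReal]) y))
  have hRc : Continuous fun y => (h y).re := Complex.continuous_re.comp hhc
  have hRs : HasCompactSupport fun y => (h y).re := hhs.comp_left Complex.zero_re
  have hη0' : ∀ g : (quasiSplit (↥(maximalRealSubfield L)) L (IsCMField.complexConj L) 3).Adelic, 0 ≤ η (adelicVal (↥(maximalRealSubfield L)) L (IsCMField.complexConj L) 3 ((StdForm.antidiagonal 3).over L) g) :=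
    fun g => hη0 _
  have hR0 : ∀ y, 0 ≤ (h y).re := fun y => selfConv_re_nonneg νG hη0' y
  have h1 : h 1 ≠ 0 :=
    selfConv_one_ne_zero νG hηr_c hηr_s hη0' (fun g => by rw [map_inv]; exact hηinv _) (g₀ := 1) (by rw [map_one, hη1]; exact one_ne_zero)
  have hR1 : (fun y => (h y).re) 1 ≠ 0 := fun h0 => h1 (by rw [← hreal 1]; simp only [h0, Complex.ofReal_zero])
  obtain ⟨g₀, hg₀, hH⟩ := exists_ne_zero_one_lt_borelHeight hRc hR1 (one_mem_closure_setOf_one_lt_borelHeight_three)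
  have hnc : ∃ z₁ z₂ : ℂ, s z₁ ≠ s z₂ := by
    obtain ⟨z₁, hz₁⟩ := exists_sphericalTransform_ne νG hRc hRs hR0 hg₀ hH (s 0)
    refine ⟨z₁, 0, ?_⟩
    simpa only [hreal] using hz₁
  refine ⟨η, hηt, hη0, hηinv, s, hsd, hs0, hnc, fun z φ hφ x => ?_⟩
  exact integral_selfConv_mul_flatSectionU_eq_sphericalTransform_mul νG (exists_mem_borelAdelic_mul_mem_standardMaximalCompactGL_cm L) hφ (hVinf φ hφ) hhK hhsupp z x

/-- **HEAD `hfam` AT MAXIMAL LEVEL** — the letter `hfam` of ★ `K2E1ChiConvDataCMThree.exists_chi_convData_cm_three` (TWIN #1) DISCHARGED at `V := chiSectionSpace χ K (fun _ => 1)` under `χ_∞ = 1` (`φ ∘ ι = φ(1)` on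
`V`): for every `z₀` a symmetric smooth `η ≥ 0` and an ENTIRE `s` (`= ĥ`, `h = η ∗ η`) with `s z₀ ≠ 0` acting on every `f_z^φ`, `φ ∈ V`. [cite: Langlands1976, §6 (p. 167)] [cite: BernsteinLapid2019, §4 Claim 1] -/
theorem hfam_maximalLevel_cm_three
    (hVinf : ∀ φ ∈ chiSectionSpace χ (((standardMaximalCompactGL 3 L).comap (adelicVal (↥(maximalRealSubfield L)) L (IsCMField.complexConj L) 3 ((StdForm.antidiagonal 3).over L)) :
      Subgroup (quasiSplit (↥(maximalRealSubfield L)) L (IsCMField.complexConj L) 3).Adelic)) (fun _ => 1),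
      ∀ a : arch (↥(maximalRealSubfield L)) L (IsCMField.complexConj L) 3 ((StdForm.antidiagonal 3).over L), φ (archToAdelic (↥(maximalRealSubfield L)) L (IsCMField.complexConj L) 3 _ a) = φ 1) :
    ∀ z₀ : ℂ, ∃ η : GL (Fin 3) (AdeleRing (𝓞 L) L) → ℝ, IsTestFunctionGL 3 L η ∧ (∀ g, 0 ≤ η g) ∧ (∀ g, η g⁻¹ = η g) ∧
      ∃ s : ℂ → ℂ, Differentiable ℂ s ∧ s z₀ ≠ 0 ∧ ∀ z : ℂ, ∀ φ ∈ chiSectionSpace χ (((standardMaximalCompactGL 3 L).comap (adelicVal (↥(maximalRealSubfield L)) L (IsCMField.complexConj L) 3 ((StdForm.antidiagonal 3).over L)) :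
      Subgroup (quasiSplit (↥(maximalRealSubfield L)) L (IsCMField.complexConj L) 3).Adelic)) (fun _ => 1), ∀ x : (quasiSplit (↥(maximalRealSubfield L)) L (IsCMField.complexConj L) 3).Adelic,
        (∫ y, (fun y : (quasiSplit (↥(maximalRealSubfield L)) L (IsCMField.complexConj L) 3).Adelic =>
            orbitalSmoothing νG (fun x : (quasiSplit (↥(maximalRealSubfield L)) L (IsCMField.complexConj L) 3).Adelic => ((η (adelicVal (↥(maximalRealSubfield L)) L (IsCMField.complexConj L) 3 ((StdForm.antidiagonal 3).over L) x) : ℝ) : ℂ))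
              (fun x : (quasiSplit (↥(maximalRealSubfield L)) L (IsCMField.complexConj L) 3).Adelic => ((η (adelicVal (↥(maximalRealSubfield L)) L (IsCMField.complexConj L) 3 ((StdForm.antidiagonal 3).over L) x) : ℝ) : ℂ)) y) y *
          flatSectionU φ z (x * y) ∂νG) = s z * flatSectionU φ z x := by
  intro z₀
  obtain ⟨η, h1, h2, h3, s, hs, hs0, -, hact⟩ := exists_testFunction_sphericalTransform_maximalLevel_cm_three L νG hVinf z₀
  exact ⟨η, h1, h2, h3, s, hs, hs0, hact⟩

/-- **HEAD `hnc` AT MAXIMAL LEVEL** — the letter `hnc` of ★ `exists_chi_convData_cm_three` DISCHARGED at `V := chiSectionSpace χ K (fun _ => 1)` under `χ_∞ = 1`: ONE symmetric smooth `η ≥ 0` with an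
entire, NON-CONSTANT symbol `s = ĥ` acting on every `f_z^φ`, `φ ∈ V` — the input of ★ 12c's `hsep` through `exists_isOpen_forall_not_hasEigenvalue_of_eq_smul`. [cite: MoeglinWaldspurger1995, II.1.2] [cite: BernsteinLapid2019, §4 Claim 1] -/
theorem hnc_maximalLevel_cm_three
    (hVinf : ∀ φ ∈ chiSectionSpace χ (((standardMaximalCompactGL 3 L).comap (adelicVal (↥(maximalRealSubfield L)) L (IsCMField.complexConj L) 3 ((StdForm.antidiagonal 3).over L)) :
      Subgroup (quasiSplit (↥(maximalRealSubfield L)) L (IsCMField.complexConj L) 3).Adelic)) (fun _ => 1),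
      ∀ a : arch (↥(maximalRealSubfield L)) L (IsCMField.complexConj L) 3 ((StdForm.antidiagonal 3).over L), φ (archToAdelic (↥(maximalRealSubfield L)) L (IsCMField.complexConj L) 3 _ a) = φ 1) :
    ∃ η : GL (Fin 3) (AdeleRing (𝓞 L) L) → ℝ, IsTestFunctionGL 3 L η ∧ (∀ g, 0 ≤ η g) ∧ (∀ g, η g⁻¹ = η g) ∧
      ∃ s : ℂ → ℂ, Differentiable ℂ s ∧ (∃ z₁ z₂ : ℂ, s z₁ ≠ s z₂) ∧ ∀ z : ℂ, ∀ φ ∈ chiSectionSpace χ (((standardMaximalCompactGL 3 L).comap (adelicVal (↥(maximalRealSubfield L)) L (IsCMField.complexConj L) 3 ((StdForm.antidiagonal 3).over L)) :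
      Subgroup (quasiSplit (↥(maximalRealSubfield L)) L (IsCMField.complexConj L) 3).Adelic)) (fun _ => 1), ∀ x : (quasiSplit (↥(maximalRealSubfield L)) L (IsCMField.complexConj L) 3).Adelic,
        (∫ y, (fun y : (quasiSplit (↥(maximalRealSubfield L)) L (IsCMField.complexConj L) 3).Adelic =>
            orbitalSmoothing νG (fun x : (quasiSplit (↥(maximalRealSubfield L)) L (IsCMField.complexConj L) 3).Adelic => ((η (adelicVal (↥(maximalRealSubfield L)) L (IsCMField.complexConj L) 3 ((StdForm.antidiagonal 3).over L) x) : ℝ) : ℂ))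
              (fun x : (quasiSplit (↥(maximalRealSubfield L)) L (IsCMField.complexConj L) 3).Adelic => ((η (adelicVal (↥(maximalRealSubfield L)) L (IsCMField.complexConj L) 3 ((StdForm.antidiagonal 3).over L) x) : ℝ) : ℂ)) y) y *
          flatSectionU φ z (x * y) ∂νG) = s z * flatSectionU φ z x := by
  obtain ⟨η, h1, h2, h3, s, hs, -, hnc, hact⟩ := exists_testFunction_sphericalTransform_maximalLevel_cm_three L νG hVinf 0
  exact ⟨η, h1, h2, h3, s, hs, hnc, hact⟩

end Heads


end Summit.HodgeConjecture.HodgeConjecture.Cruxes.H413.K2E1ChiConvDataLettersMaximalLevelU3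

end
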